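import Summits.Ventures.PercRepro.S1CoreCapSevenLink

/-!
# PercRepro — `Q*(7) = 19`: THREE PAIRWISE DISJOINT BIG LINES (p1, gen 26)

Case (A0) of the last open case. With three pairwise disjoint lines of `≥ 4` points, any two further lines `X, Y`
give the list `[L₃, L₂, L₁, Y, X]` a cost `≥ 1 + 1 + 2 + 2 + 2 = 8` — each big line meets the union of the earlier
lines in at most two points — so there is at most one further line (`card_rest_le_one_of_disjoint`) and the cap sum
is `≤ 5 + 5 + 5 + 3` (`sum_cap_le_nineteen_of_three_disjoint`). `proofs/P1-S4-CAPBRIDGE.md` §18 (A0).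
Axioms: standard.
-/

namespace PercRepro

namespace S1

namespace FourCap

namespace Seven

variable {β : Type} [DecidableEq β]

omit [DecidableEq β] in
/-- The cap of a 3-point line is at most `3`. -/
theorem capPaper_three_le (f : ℕ) : capPaper 3 f ≤ 3 := by
  unfold capPaper
  split <;> omega

section ThreeNon

variable {w : β → ℕ} {ls : Finset (Finset β)}
  (h1 : ∀ L ∈ ls, ∀ v ∈ L, w v = 1 ∨ w v = 2)
  (h2 : ∀ L ∈ ls, 3 ≤ L.card ∧ wsum w L ≤ 5)
  (h3 : ∀ L ∈ ls, ∀ L' ∈ ls, L ≠ L' → (L ∩ L').card ≤ 1)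
  (h4 : ∀ l : List (Finset β), l.Nodup → (∀ L ∈ l, L ∈ ls) → wsum w (unionL l) ≤ 7 + lineRank l)
  (h5 : ∀ l : List (Finset β), l.Nodup → (∀ L ∈ l, L ∈ ls) → lineRank l ≤ 3 → (unionL l).card ≤ 9)
  {L₁ L₂ L₃ : Finset β} (hL₁ : L₁ ∈ ls) (hL₂ : L₂ ∈ ls) (hL₃ : L₃ ∈ ls)
  (h12 : L₂ ≠ L₁) (h13 : L₃ ≠ L₁) (h23 : L₃ ≠ L₂)
  (c1 : 4 ≤ L₁.card) (c2 : 4 ≤ L₂.card) (c3 : 4 ≤ L₃.card)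
  (hrest : ∀ L ∈ ls, L ≠ L₁ → L ≠ L₂ → L ≠ L₃ → L.card = 3)

include h1 h2 h3 h4 hL₁ hL₂ hL₃ h12 h13 h23 c1 c2 c3 hrest in
/-- **(A0) With three pairwise disjoint big lines there is at most one further line**: two of them would give
`[L₃, L₂, L₁, Y, X]` a cost `≥ 8`. -/
theorem card_rest_le_one_of_disjoint (d12 : (L₂ ∩ L₁).card = 0) (d13 : (L₃ ∩ L₁).card = 0)
    (d23 : (L₃ ∩ L₂).card = 0) : (((ls.erase L₁).erase L₂).erase L₃).card ≤ 1 := by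
  rw [Finset.card_le_one]
  intro X hX Y hY
  by_contra hXY
  have hXm : X ∈ ls ∧ X ≠ L₁ ∧ X ≠ L₂ ∧ X ≠ L₃ := by
    have a := Finset.mem_erase.1 hX; have b := Finset.mem_erase.1 a.2; have c := Finset.mem_erase.1 b.2
    exact ⟨c.2, c.1, b.1, a.1⟩
  have hYm : Y ∈ ls ∧ Y ≠ L₁ ∧ Y ≠ L₂ ∧ Y ≠ L₃ := by
    have a := Finset.mem_erase.1 hY; have b := Finset.mem_erase.1 a.2; have c := Finset.mem_erase.1 b.2
    exact ⟨c.2, c.1, b.1, a.1⟩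
  obtain ⟨hXs, hX1, hX2, hX3⟩ := hXm
  obtain ⟨hYs, hY1, hY2, hY3⟩ := hYm
  have kX := hrest X hXs hX1 hX2 hX3
  have kY := hrest Y hYs hY1 hY2 hY3
  have hc := costSum_le h1 (two_le_card_of_spec₇ h2) h4 [L₃, L₂, L₁, Y, X]
    (by simp [h12, h13, h23, hX1.symm, hX2.symm, hX3.symm, hY1.symm, hY2.symm, hY3.symm, Ne.symm hXY])
    (by simp [hL₁, hL₂, hL₃, hXs, hYs])
  simp only [costSum, unionL, Finset.union_empty, Nat.zero_add] at hc
  have e0 := lineCost_empty w X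
  have e1 := lineCost_of_inter_le_two (w := w) (L := Y) (U := X) (le_trans (h3 Y hYs X hXs (Ne.symm hXY)) (by omega))
  have e2 := lineCost_ge (w := w) L₁ (Y ∪ X)
  have e3 := lineCost_ge (w := w) L₂ (L₁ ∪ (Y ∪ X))
  have e4 := lineCost_ge (w := w) L₃ (L₂ ∪ (L₁ ∪ (Y ∪ X)))
  have i2 : (L₁ ∩ (Y ∪ X)).card ≤ 2 := le_trans (card_inter_union_le L₁ Y X)
    (by have := h3 L₁ hL₁ Y hYs hY1.symm; have := h3 L₁ hL₁ X hXs hX1.symm; omega)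
  have i3 : (L₂ ∩ (L₁ ∪ (Y ∪ X))).card ≤ 2 := le_trans (card_inter_union_le L₂ L₁ (Y ∪ X))
    (le_trans (Nat.add_le_add_left (card_inter_union_le L₂ Y X) _)
      (by have := h3 L₂ hL₂ Y hYs hY2.symm; have := h3 L₂ hL₂ X hXs hX2.symm; omega))
  have i4 : (L₃ ∩ (L₂ ∪ (L₁ ∪ (Y ∪ X)))).card ≤ 2 := le_trans (card_inter_union_le L₃ L₂ (L₁ ∪ (Y ∪ X)))
    (le_trans (Nat.add_le_add_left (card_inter_union_le L₃ L₁ (Y ∪ X)) _)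
      (le_trans (Nat.add_le_add_left (Nat.add_le_add_left (card_inter_union_le L₃ Y X) _) _)
        (by have := h3 L₃ hL₃ Y hYs hY3.symm; have := h3 L₃ hL₃ X hXs hX3.symm; omega)))
  omega

include h1 h2 h3 h4 hL₁ hL₂ hL₃ h12 h13 h23 c1 c2 c3 hrest in
/-- **(A0) Three pairwise disjoint big lines: cap sum `≤ 19`** (in fact `≤ 18`). -/
theorem sum_cap_le_nineteen_of_three_disjoint (d12 : (L₂ ∩ L₁).card = 0) (d13 : (L₃ ∩ L₁).card = 0)
    (d23 : (L₃ ∩ L₂).card = 0) : ∑ L ∈ ls, capPaper L.card (fat w L) ≤ 19 := by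
  have hT := card_rest_le_one_of_disjoint h1 h2 h3 h4 hL₁ hL₂ hL₃ h12 h13 h23 c1 c2 c3 hrest d12 d13 d23
  set T := ((ls.erase L₁).erase L₂).erase L₃ with hTdef
  have hs1 := Finset.add_sum_erase ls (fun L => capPaper L.card (fat w L)) hL₁
  have hs2 := Finset.add_sum_erase (ls.erase L₁) (fun L => capPaper L.card (fat w L))
    (Finset.mem_erase.2 ⟨h12, hL₂⟩)
  have hs3 := Finset.add_sum_erase ((ls.erase L₁).erase L₂) (fun L => capPaper L.card (fat w L))
    (Finset.mem_erase.2 ⟨h23, Finset.mem_erase.2 ⟨h13, hL₃⟩⟩)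
  rw [← hTdef] at hs3
  rw [← hs1, ← hs2, ← hs3, capPaper_big_eq h1 h2 hL₁ c1, capPaper_big_eq h1 h2 hL₂ c2, capPaper_big_eq h1 h2 hL₃ c3]
  have hTcap : ∑ L ∈ T, capPaper L.card (fat w L) ≤ 3 := by
    have : ∀ L ∈ T, capPaper L.card (fat w L) ≤ 3 := by
      intro L hL
      have a := Finset.mem_erase.1 hL; have b := Finset.mem_erase.1 a.2; have c := Finset.mem_erase.1 b.2
      rw [hrest L c.2 c.1 b.1 a.1]
      exact capPaper_three_le _
    refine (Finset.sum_le_sum this).trans ?_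
    rw [Finset.sum_const_nat (m := 3) (fun _ _ => rfl)]
    omega
  have w1 := wsum_eq_card_add_fat w L₁ (h1 L₁ hL₁)
  have w2 := wsum_eq_card_add_fat w L₂ (h1 L₂ hL₂)
  have w3 := wsum_eq_card_add_fat w L₃ (h1 L₃ hL₃)
  have := (h2 L₁ hL₁).2
  have := (h2 L₂ hL₂).2
  have := (h2 L₃ hL₃).2
  omega

end ThreeNon

end Seven

end FourCap

end S1

end PercRepro
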